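/-
Copyright: statement-level skeleton of a published paper (lit-balaban cell, Phase-2 proof seat p39 gen 15). No proof claims
beyond what the kernel checks below.
-/
import Literature.MathematicalPhysics.QuantumFieldTheory.Balaban1983to89.B3WT228FreeGaussian
import Literature.MathematicalPhysics.QuantumFieldTheory.Balaban1983to89.B3WTKernelWardIdentity

/-!
# B3 — T. Bałaban, *(Higgs)₂,₃ quantum fields in a finite volume. III. Renormalization*, CMP **88** (1983) 411–445
[Balaban1983Higgs3], p. 431 [PDF 21] L20–22 after (2.28): **"Taking other functions F … we can get all necessary Ward–Takahashi
identities. They hold for free boundary conditions also" — THE IDENTITY FOR `F(φ) = :|φ(z)|²:` (the functions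
`−½δm²_l(x):|φ(x)|²:`, `−λ_kC^η_{M²}(0):|φ(x)|²:` of p. 430) AT FREE BOUNDARY CONDITIONS, DRAWN ON THE INFINITE LATTICE `ηℤ^d`**:
for the Gaussian field `dμ_C` of every positive semidefinite colour-diagonal kernel `δ_{ab}C(x − y)` the Gaussian left member
`∫dμ_C :|φ(z)|²:_C·[(−e⟨∂^ηφ,Bqφ⟩)(:⟨∂^ηφ,∂^ηλqφ⟩:) − e⟨φ,B·∂^ηλq²φ⟩ − ηe⟨∂^ηφ,B∂^ηλq²φ⟩]` equals the sum of its one-loop graphs —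
the triangles through `z` from the two current vertices and the tadpoles opened at `z` —, and WHEN `C` IS EVEN AND SOLVES THE LATTICE
EQUATION `(−Δ^η + M²)C = η^{−d}δ` (free boundary conditions: `C = C^η_{M²}`, `dμ_{C^η_{M²}}` of `B3WTFreeMeasure`) that sum is `0` for
every site `z`, by the kernel Ward–Takahashi identity of `B3WTKernelWardIdentity` (file 2/2 of this seat's "other functions F"
target; file 1/2 = `B3WTKernelWardIdentity`)

statement-level skeleton of published theorems with citation tags; proofs where landed; nothing here is a claim about
the Yang–Mills mass gap

PDF held: `paper:balaban1983-higgs-2-3-quantum-fields-finite-volume` (journal page = PDF page + 410); p. 431 [PDF 21] re-read for this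
file (text layer `p0021.txt` L14–22), p. 430 [PDF 20] for the admissible `F`.

CITATION HEADER (lean-in-tree rule).  Part of the lit-balaban TYPED SKELETON (HOME `run/shared/lean/pub/lit-balaban/`), PHASE 2,
proof seat p39 (generation 15).  Row **B3.Eq2.26-2.28** of `HOME/lit-balaban-r15/ROWS-B3.md` (fold owner r15); the owner's head
question of 2026-08-22T17:43Z names as residual prose the two sentences quoted in the title.  On `ηℤ^d` the tree has (2.25)/(2.26)
at free boundary conditions (gen 11/12: `B3WT226FreeLattice`, `B3WT226PeriodicLimit`, `B3WT226FreeGaussian`, `B3WTPeriodicMeasure`) and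
(2.28) (gen 15: `B3FreeWickVertexCalculus`, `B3WT228FreeGaussian`); the `F = :|φ(z)|²:` identity was drawn on the MODEL TORUS only
(gen 14 `B3WT228Phi2Graphs`: left member `= 0` by the gauge covariance (2.24) of `B3WT228Left`, right member = one-loop graphs).
THIS FILE transcribes it to `ηℤ^d` with the architecture of `B3WT228FreeGaussian`: the two-leg vertex `wick2K` of
`B3FreeWickVertexCalculus`, the engine `GaussianWick.integral_wick2_mul_prod` on the Gaussian process of field insertions
(`B3GaussianContractions.isGaussianProcess_inner_fld`), the ℤ^d pairings `curJ`/`pairD`/`locQ`/`derQ`/`normOrd` of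
`B3WT226FreeGaussian`, the printed integrand `integrand226` of `B3WTPeriodicMeasure`, `B3WT228FreeGaussian.JJ_expand`, the trace
identities `B3WTWick.sum_inner_mul_inner_qq/_q_q`, `B3WT226Pairings.inner_q_self` BY NAME — and, since on `ηℤ^d` there is no (2.24)
to make the left member vanish, it closes the identity on the GRAPH side: the graphs sum to zero by
`B3WTKernelWardIdentity.current_insertion_eq`.

THE PRINTED TEXT (verbatim, pp. 430–431 [PDF 20–21]).  p. 430: *"[F(φ) is chosen as a polynomial, e.g. we can take
F(φ) = −λ_k:|φ(x)|⁴:, or F(φ) = −½δm²_l(x):|φ(x)|²:, or F(φ) = −λ_kC^η_{M²}(0):|φ(x)|²:]"*;  p. 431 L20–23: *"Taking other functions F,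
or differentiating (2.24) to higher order in A, we can get all necessary Ward-Takahashi identities. They hold for free boundary
conditions also by taking a limit of the identities with periodic boundary conditions. Each such identity is connected with some
set of graphs."*

WHAT IS PROVED (theorems only; `d`, `N` arbitrary; `C : ℤ^d → ℝ` with `δ_{ab}C(x − y)` positive semidefinite — hypothesis `hK`;
`dμ_C = kernelMeasure d N C`; `τ := tr q² = trE(q∘q)`; external legs `B` (print: `A`) and `∂^ηλ` on the bonds based in a window `S`;
charge `e = C.e`, antisymmetric `q = C.q` of the model's `HiggsLattice.ChargeData`).
* §1 the two-leg vertex against legs: `wick2K_eq_sum_pair` (`:|φ(x)|²: = Σ_a(φ_a(x)² − C(0))`), `integrable_wick2K_mul_prod`,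
  **`integral_wick2K_mul_prod`** — THE CONTRACTION RULE `∫ :|φ(x)|²: ∏_{j∈s}⟪φ(y_j),u_j⟫ dμ_C =
  Σ_{i≠i′∈s}C(x−y_i)C(x−y_{i′})⟪u_i,u_{i′}⟫∫∏_{j∈s∖{i,i′}}⟪φ(y_j),u_j⟫dμ_C` (no self-line at `x`), `integral_wick2K_mul_two`
  (`= 2C(x−y₀)C(x−y₁)⟪u₀,u₁⟫`), **`integral_wick2K_mul_four`** (`= 2Σ_{six splittings}C(x−y_i)C(x−y_{i′})⟪u_i,u_{i′}⟫·C(y_k−y_l)⟪u_k,u_l⟫`),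
  `integrable_wick2K_mul_two/_four`.
* §2 the pictures: **`integral_wick2K_biq`** (the tadpole opened at `z`: `∫ :|φ(z)|²:⟪φ(y),Qφ(y′)⟫ = 2C(z−y)C(z−y′)tr Q`),
  **`integral_wick2K_JJ`** (the triangles: `∫ :|φ(z)|²:⟪φ(y₁),qφ(y₂)⟫⟪φ(y₃),qφ(y₄)⟫ = −2τ[C(z−y₁)C(z−y₃)C(y₂−y₄) − C(z−y₁)C(z−y₄)C(y₂−y₃)
  − C(z−y₂)C(z−y₃)C(y₁−y₄) + C(z−y₂)C(z−y₄)C(y₁−y₃)]`), `integrable_wick2K_mul_biq/_mul_JJ`.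
* §3 the identity: `integral_wick2K_curJ_pairD(_expand)`, `integral_wick2K_locQ`, `integral_wick2K_derQ` (+ integrability),
  `phi2_integrand_splitK`, `integrable_wick2K_integrand`, **`eq_phi2_wickK`** (THE GAUSSIAN LEFT MEMBER `=` the explicit sum of one-loop
  graphs, spelled out in the statement: `−eΣ_{b,b′}(η^dB_bη⁻¹)(η^d(∂^ηλ)(b′)η⁻¹)(−2τ)[4 triangles] − eΣ_bη^dB_b(∂^ηλ)(b)·2C(z−b₋)²τ
  − ηeΣ_bη^dB_b(∂^ηλ)(b)η⁻¹·2τ[C(z−b₊)C(z−b₋) − C(z−b₋)²]`, every kernel), **`phi2Graphs_eq_zeroK`** (THAT SUM IS `0` for `η ≠ 0`, `C`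
  even solving the lattice equation, `λ` supported in a finite `T`, `S ⊇ T ∪ ⋃_ν(T − e_ν)` — by `current_insertion_eq` at `(z, b₊)` and
  `(z, b₋)`: the `b′`-summed triangles give `−2τe·η^dB_b(∂^ηλ)(b)C(z−b₋)C(z−b₊)·(…)` which the opened tadpoles cancel),
  **`eq_phi2_kernel`** (`∫dμ_C :|φ(z)|²:·[…] = 0`), `eq_phi2_kernel_weighted` (`F = Σ_{z∈Δ}η^dβ(z):|φ(z)|²:`), and the free instances
  **`eq_phi2_free`** (`C = C^η_{M²}`, `η > 0`, `M² > 0`, `dμ_{C^η_{M²}}`), `eq_phi2_free_dSupp` (window `dSupp T`), `eq_phi2_free_weighted`,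
  `eq_phi2_free_graphs` (the graph sum with propagators `C^η_{M²}` displayed `= 0`).
HONEST SCOPE: (i) the LEFT member here is the Gaussian integral of the printed (2.26)-integrand times `:|φ(z)|²:` against `dμ_C` (as
in `B3WT226FreeGaussian`/`B3WT228FreeGaussian`); its derivation as the `A`-derivative of (2.24) with `F` inserted stays on the model
torus (`B3WT228Left.eq228_deriv`, `B3WT228Phi2Graphs.eq228_phi2_left`); (ii) the print's route *"by taking a limit of the identities
with periodic boundary conditions"* is NOT replayed: the identity is proved directly on `ηℤ^d` for every even solution of the
lattice equation; the periodic kernels `C_L` solve the lattice equation with the PERIODIC delta (`B3WT226PeriodicLimit.negLapZ_perC_add`)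
and are not covered by `eq_phi2_kernel` as stated (for them `eq_phi2_wickK` still evaluates the left member); (iii) unlike (2.28),
whose single picture vanishes for every kernel (`B3WT228FreeGaussian`), the `:|φ(z)|²:` graphs vanish only in the sum and only for the
propagator of `−Δ^η + M²`; (iv) finitely supported `λ`, `B` on the bonds of a finite window, the identity sitewise in `z` and for
finite weighted sums over `z`; "differentiating (2.24) to higher order in A" is not done.  Mathlib + the cited tree files only;
theorems, no definition, no named fact, no `sorry`; standard axioms.  Unit `lit-balaban-p39-g15` (Phase-2 proof seat p39, gen 15),
HOME `run/shared/lean/pub/lit-balaban/`, 2026-08-22.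

References: [Balaban1983Higgs3] T. Bałaban, CMP 88 (1983) 411–445, (2.24)–(2.28) pp. 430–431; [GlimmJaffeQP1987] J. Glimm,
A. Jaffe, *Quantum Physics*, 2nd ed. (1987), Prop. 8.3.1 (8.3.5), Cor. 8.3.2 (8.3.8)–(8.3.9); [Janson1997] S. Janson, *Gaussian
Hilbert Spaces* (1997), Thm 1.28.
-/

noncomputable section

open scoped BigOperators InnerProductSpace
open MeasureTheory ProbabilityTheory Finset

namespace Literature.MathematicalPhysics.QuantumFieldTheory.Balaban1983to89.B3WT228Phi2FreeGaussian

open B3Sect3VectorSelfEnergy B3CxiPropagator B3WT226FreeLattice B3WTFreeMeasure B3WTFreeWick B3GaussianContractions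
open B3WT226FreeGaussian B3WT226PeriodicLimit B3WTPeriodicMeasure B3FreeWickVertexCalculus B3WTKernelWardIdentity
open B3WTCovariance (trE)
open B3WT226Pairings (inner_q_self inner_q_left)
open B3WTWick (inner_q_expand sum_inner_mul_inner_qq sum_inner_mul_inner_q_q)
open B3WT228FreeGaussian (JJ_expand)
open Literature.MathematicalPhysics.QuantumFieldTheory
open Literature.Probability.Distributions

variable {d N : ℕ} (C : HiggsLattice.ChargeData N) (η : ℝ) {Cv : ZSite d → ℝ} {M2 : ℝ}

/-! ## §1 The Wick-ordered square `:|φ(z)|²:_C` against legs: both legs contracted outward (the engine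
`GaussianWick.integral_wick2_mul_prod` on the Gaussian process of field insertions `⟪φ(y),u⟫` under `dμ_C`) -/

section Engine

/-- `|φ(x)|² = Σ_a ⟪φ(x),e_a⟫²` (Parseval in `R^N`). [folklore] -/
private theorem norm_sq_fld_eq_sum (ω : Cfg d N) (x : ZSite d) :
    ‖fld ω x‖ ^ 2 = ∑ a : Fin N, ⟪fld ω x, EuclideanSpace.basisFun (Fin N) ℝ a⟫_ℝ * ⟪fld ω x, EuclideanSpace.basisFun (Fin N) ℝ a⟫_ℝ := by
  rw [← real_inner_self_eq_norm_sq, ← (EuclideanSpace.basisFun (Fin N) ℝ).sum_inner_mul_inner (fld ω x) (fld ω x)]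
  exact Finset.sum_congr rfl fun a _ => by rw [real_inner_comm (EuclideanSpace.basisFun (Fin N) ℝ a)]

/-- `⟪e_a, e_a⟫ = 1`. [folklore] -/
private theorem inner_basis_self (a : Fin N) :
    ⟪EuclideanSpace.basisFun (Fin N) ℝ a, EuclideanSpace.basisFun (Fin N) ℝ a⟫_ℝ = 1 := by
  rw [real_inner_self_eq_norm_sq, (EuclideanSpace.basisFun (Fin N) ℝ).orthonormal.1 a, one_pow]

/-- `Σ_a ⟪e_a,u⟫⟪e_a,v⟫ = ⟪u,v⟫` (Parseval). [folklore] -/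
private theorem sum_inner_basis_mul (u v : EuclideanSpace ℝ (Fin N)) :
    ∑ a : Fin N, ⟪EuclideanSpace.basisFun (Fin N) ℝ a, u⟫_ℝ * ⟪EuclideanSpace.basisFun (Fin N) ℝ a, v⟫_ℝ = ⟪u, v⟫_ℝ := by
  rw [← (EuclideanSpace.basisFun (Fin N) ℝ).sum_inner_mul_inner u v]
  exact Finset.sum_congr rfl fun a _ => by rw [real_inner_comm u]

/-- **`:|φ(x)|²:` as the sum over the colours of Wick-ordered pairs of legs** `X_aX_a − S_{aa}` in the sense of Glimm–Jaffe
(8.3.5) / `GaussianWick` §9, with the self-line value `S_{aa} = C(0)⟪e_a,e_a⟫`. [cite: GlimmJaffeQP1987, Prop. 8.3.1 (8.3.5)] -/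
theorem wick2K_eq_sum_pair (ω : Cfg d N) (x : ZSite d) :
    wick2K Cv ω x = ∑ a : Fin N,
      (⟪fld ω x, EuclideanSpace.basisFun (Fin N) ℝ a⟫_ℝ * ⟪fld ω x, EuclideanSpace.basisFun (Fin N) ℝ a⟫_ℝ
        - Cv 0 * ⟪EuclideanSpace.basisFun (Fin N) ℝ a, EuclideanSpace.basisFun (Fin N) ℝ a⟫_ℝ) := by
  simp only [inner_basis_self, mul_one]
  rw [wick2K_def, norm_sq_fld_eq_sum, Finset.sum_sub_distrib, Finset.sum_const, Finset.card_univ, Fintype.card_fin,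
    nsmul_eq_mul]

/-- products of legs times products of legs are integrable (one product over the sum of the index types). [folklore] -/
private theorem integrable_prod_mul_prod (hK : IsPosSemidefKernel (scalarKernel d N Cv)) {ι κ : Type*} (t : Finset ι)
    (zs : ι → ZSite d) (ws : ι → EuclideanSpace ℝ (Fin N)) (s : Finset κ) (ys : κ → ZSite d) (us : κ → EuclideanSpace ℝ (Fin N)) :
    Integrable (fun ω => (∏ i ∈ t, ⟪fld ω (zs i), ws i⟫_ℝ) * ∏ j ∈ s, ⟪fld ω (ys j), us j⟫_ℝ) (kernelMeasure d N Cv) := by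
  have h := GaussianWick.integrable_prod (isGaussianProcess_inner_fld hK) (t.disjSum s)
    (Sum.elim (fun i => (zs i, ws i)) (fun j => (ys j, us j)))
  refine h.congr (ae_of_all _ fun ω => ?_)
  simp only [Finset.prod_disjSum, Sum.elim_inl, Sum.elim_inr]

/-- **`:|φ(x)|²:` times any product of legs is integrable** under `dμ_C` (a polynomial in the Gaussian legs).
[cite: Janson1997, Ch. 1 §3, sentence before Thm 1.28] -/
theorem integrable_wick2K_mul_prod (hK : IsPosSemidefKernel (scalarKernel d N Cv)) (x : ZSite d) {κ : Type*} (s : Finset κ)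
    (ys : κ → ZSite d) (us : κ → EuclideanSpace ℝ (Fin N)) :
    Integrable (fun ω => wick2K Cv ω x * ∏ j ∈ s, ⟪fld ω (ys j), us j⟫_ℝ) (kernelMeasure d N Cv) := by
  have i2 : ∀ a : Fin N, Integrable (fun ω => (∏ i : Fin 2, ⟪fld ω x, EuclideanSpace.basisFun (Fin N) ℝ (![a, a] i)⟫_ℝ) *
      ∏ j ∈ s, ⟪fld ω (ys j), us j⟫_ℝ) (kernelMeasure d N Cv) := fun a =>
    integrable_prod_mul_prod hK Finset.univ (fun _ => x) (fun i => EuclideanSpace.basisFun (Fin N) ℝ (![a, a] i)) s ys us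
  have i0 : Integrable (fun ω => ∏ j ∈ s, ⟪fld ω (ys j), us j⟫_ℝ) (kernelMeasure d N Cv) :=
    GaussianWick.integrable_prod (isGaussianProcess_inner_fld hK) s (fun j => (ys j, us j))
  have hexp : (fun ω => wick2K Cv ω x * ∏ j ∈ s, ⟪fld ω (ys j), us j⟫_ℝ) = fun ω =>
      (∑ a : Fin N, (∏ i : Fin 2, ⟪fld ω x, EuclideanSpace.basisFun (Fin N) ℝ (![a, a] i)⟫_ℝ) *
          ∏ j ∈ s, ⟪fld ω (ys j), us j⟫_ℝ)
        - N * Cv 0 * ∏ j ∈ s, ⟪fld ω (ys j), us j⟫_ℝ := by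
    funext ω
    rw [wick2K_def, norm_sq_fld_eq_sum, sub_mul, Finset.sum_mul]
    simp only [Fin.prod_univ_two, Matrix.cons_val_zero, Matrix.cons_val_one]
  rw [hexp]
  exact (integrable_finsetSum _ fun a _ => i2 a).sub (i0.const_mul _)

/-- the Wick-ordered pair summand of `wick2K_eq_sum_pair` times a product of legs is integrable. [folklore] -/
private theorem integrable_pair_mul_prod (hK : IsPosSemidefKernel (scalarKernel d N Cv)) (x : ZSite d) (a : Fin N)
    {κ : Type*} (s : Finset κ) (ys : κ → ZSite d) (us : κ → EuclideanSpace ℝ (Fin N)) :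
    Integrable (fun ω =>
      (⟪fld ω x, EuclideanSpace.basisFun (Fin N) ℝ a⟫_ℝ * ⟪fld ω x, EuclideanSpace.basisFun (Fin N) ℝ a⟫_ℝ
          - Cv 0 * ⟪EuclideanSpace.basisFun (Fin N) ℝ a, EuclideanSpace.basisFun (Fin N) ℝ a⟫_ℝ) *
        ∏ j ∈ s, ⟪fld ω (ys j), us j⟫_ℝ) (kernelMeasure d N Cv) := by
  have i2 : Integrable (fun ω => (∏ i : Fin 2, ⟪fld ω x, EuclideanSpace.basisFun (Fin N) ℝ (![a, a] i)⟫_ℝ) *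
      ∏ j ∈ s, ⟪fld ω (ys j), us j⟫_ℝ) (kernelMeasure d N Cv) :=
    integrable_prod_mul_prod hK Finset.univ (fun _ => x) (fun i => EuclideanSpace.basisFun (Fin N) ℝ (![a, a] i)) s ys us
  have i0 : Integrable (fun ω => ∏ j ∈ s, ⟪fld ω (ys j), us j⟫_ℝ) (kernelMeasure d N Cv) :=
    GaussianWick.integrable_prod (isGaussianProcess_inner_fld hK) s (fun j => (ys j, us j))
  refine (i2.sub (i0.const_mul (Cv 0 * ⟪EuclideanSpace.basisFun (Fin N) ℝ a, EuclideanSpace.basisFun (Fin N) ℝ a⟫_ℝ))).congr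
    (ae_of_all _ fun ω => ?_)
  simp only [Fin.prod_univ_two, Matrix.cons_val_zero, Matrix.cons_val_one, Pi.sub_apply]
  ring

/-- **THE CONTRACTION RULE FOR `:|φ(x)|²:` AGAINST A PRODUCT OF LEGS** (Glimm–Jaffe Cor. 8.3.2 for one two-leg vertex, the engine
`GaussianWick.integral_wick2_mul_prod` applied to the Gaussian process of field insertions under `dμ_C`, the colour of the vertex
summed): for a positive semidefinite colour-diagonal kernel `δ_{ab}C(x − y)`,
`∫ :|φ(x)|²: ∏_{j∈s}⟪φ(y_j),u_j⟫ dμ_C = Σ_{i ≠ i′ ∈ s} C(x−y_i)C(x−y_{i′})⟪u_i,u_{i′}⟫ ∫ ∏_{j∈s∖{i,i′}}⟪φ(y_j),u_j⟫ dμ_C` — both legs of the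
Wick-ordered vertex are contracted into the other factors, no self-line at `x` (the torus twin: `B3WickVertexCalculus.integral_wick2_mul`).
[cite: GlimmJaffeQP1987, Cor. 8.3.2 (8.3.8)–(8.3.9)] -/
theorem integral_wick2K_mul_prod (hK : IsPosSemidefKernel (scalarKernel d N Cv)) (x : ZSite d) {κ : Type*} [DecidableEq κ]
    (s : Finset κ) (ys : κ → ZSite d) (us : κ → EuclideanSpace ℝ (Fin N)) :
    ∫ ω, wick2K Cv ω x * ∏ j ∈ s, ⟪fld ω (ys j), us j⟫_ℝ ∂kernelMeasure d N Cv =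
      ∑ i ∈ s, ∑ i' ∈ s.erase i, Cv (x - ys i) * Cv (x - ys i') * ⟪us i, us i'⟫_ℝ *
        ∫ ω, ∏ j ∈ (s.erase i).erase i', ⟪fld ω (ys j), us j⟫_ℝ ∂kernelMeasure d N Cv := by
  have hX := isGaussianProcess_inner_fld hK
  have h0 : ∀ p : ZSite d × EuclideanSpace ℝ (Fin N), ∫ ω, ⟪fld ω p.1, p.2⟫_ℝ ∂kernelMeasure d N Cv = 0 :=
    fun p => integral_inner_fld hK p.1 p.2
  have hsplit : (fun ω => wick2K Cv ω x * ∏ j ∈ s, ⟪fld ω (ys j), us j⟫_ℝ) = fun ω => ∑ a : Fin N,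
      (⟪fld ω x, EuclideanSpace.basisFun (Fin N) ℝ a⟫_ℝ * ⟪fld ω x, EuclideanSpace.basisFun (Fin N) ℝ a⟫_ℝ
          - Cv 0 * ⟪EuclideanSpace.basisFun (Fin N) ℝ a, EuclideanSpace.basisFun (Fin N) ℝ a⟫_ℝ) *
        ∏ j ∈ s, ⟪fld ω (ys j), us j⟫_ℝ := by
    funext ω
    rw [wick2K_eq_sum_pair, Finset.sum_mul]
  have hper : ∀ a : Fin N, ∫ ω, (⟪fld ω x, EuclideanSpace.basisFun (Fin N) ℝ a⟫_ℝ * ⟪fld ω x, EuclideanSpace.basisFun (Fin N) ℝ a⟫_ℝ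
          - Cv 0 * ⟪EuclideanSpace.basisFun (Fin N) ℝ a, EuclideanSpace.basisFun (Fin N) ℝ a⟫_ℝ) *
        ∏ j ∈ s, ⟪fld ω (ys j), us j⟫_ℝ ∂kernelMeasure d N Cv =
      ∑ i ∈ s, ∑ i' ∈ s.erase i, (Cv (x - ys i) * ⟪EuclideanSpace.basisFun (Fin N) ℝ a, us i⟫_ℝ) *
        (Cv (x - ys i') * ⟪EuclideanSpace.basisFun (Fin N) ℝ a, us i'⟫_ℝ) *
          ∫ ω, ∏ j ∈ (s.erase i).erase i', ⟪fld ω (ys j), us j⟫_ℝ ∂kernelMeasure d N Cv := by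
    intro a
    have h := GaussianWick.integral_wick2_mul_prod hX h0 (x, EuclideanSpace.basisFun (Fin N) ℝ a)
      (x, EuclideanSpace.basisFun (Fin N) ℝ a) s (fun j => (ys j, us j))
    dsimp only at h
    simp only [integral_inner_fld_inner_fldK hK, sub_self] at h
    exact h
  rw [hsplit, integral_finsetSum _ (fun a _ => integrable_pair_mul_prod hK x a s ys us)]
  rw [Finset.sum_congr rfl fun a _ => hper a, Finset.sum_comm]
  refine Finset.sum_congr rfl fun i _ => ?_
  rw [Finset.sum_comm]
  refine Finset.sum_congr rfl fun i' _ => ?_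
  rw [← sum_inner_basis_mul (us i) (us i'), Finset.mul_sum, Finset.sum_mul]
  exact Finset.sum_congr rfl fun a _ => by ring

/-- **both legs into two external legs**: `∫ :|φ(x)|²:_C ⟪φ(y₀),u₀⟫⟪φ(y₁),u₁⟫ dμ_C = 2·C(x−y₀)C(x−y₁)·⟪u₀,u₁⟫` (the two orderings).
[cite: GlimmJaffeQP1987, Cor. 8.3.2 (8.3.8)–(8.3.9)] -/
theorem integral_wick2K_mul_two (hK : IsPosSemidefKernel (scalarKernel d N Cv)) (x y₀ y₁ : ZSite d)
    (u₀ u₁ : EuclideanSpace ℝ (Fin N)) :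
    ∫ ω, wick2K Cv ω x * (⟪fld ω y₀, u₀⟫_ℝ * ⟪fld ω y₁, u₁⟫_ℝ) ∂kernelMeasure d N Cv =
      2 * (Cv (x - y₀) * Cv (x - y₁)) * ⟪u₀, u₁⟫_ℝ := by
  haveI := isProbabilityMeasure_kernelMeasure hK
  have h := integral_wick2K_mul_prod hK x (Finset.univ : Finset (Fin 2)) ![y₀, y₁] ![u₀, u₁]
  simp only [Fin.prod_univ_two, Matrix.cons_val_zero, Matrix.cons_val_one] at h
  rw [h]
  have hu : (Finset.univ : Finset (Fin 2)) = {0, 1} := by decide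
  rw [hu]
  simp [Finset.sum_insert, Finset.erase_insert_of_ne, real_inner_comm u₀ u₁]
  ring

/-- the sum over ordered pairs of distinct indices of `{0,1,2,3}` of a symmetric `F(i,i′)` times a function of the complementary
pair — the `12 = 2·6` complete contractions of the two vertex legs with four external legs, grouped by the splitting
`{i,i′} ⊔ {k,l}`. [folklore] -/
private theorem sum_distinct2 (F : Fin 4 → Fin 4 → ℝ) (R : Finset (Fin 4) → ℝ) (hF : ∀ i i', F i i' = F i' i) :
    ∑ i : Fin 4, ∑ i' ∈ Finset.univ.erase i, F i i' * R ((Finset.univ.erase i).erase i') =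
      2 * (F 0 1 * R {2, 3} + F 0 2 * R {1, 3} + F 0 3 * R {1, 2} + F 1 2 * R {0, 3} + F 1 3 * R {0, 2}
        + F 2 3 * R {0, 1}) := by
  have hu : (Finset.univ : Finset (Fin 4)) = {0, 1, 2, 3} := by decide
  rw [hu]
  simp [Finset.sum_insert, Finset.erase_insert_of_ne]
  rw [hF 1 0, hF 2 0, hF 3 0, hF 2 1, hF 3 1, hF 3 2]
  ring

/-- **both legs into four external legs**: `∫ :|φ(x)|²:_C ∏_{j<4}⟪φ(y_j),u_j⟫ dμ_C
= 2·Σ_{{i,i′}⊔{k,l}} C(x−y_i)C(x−y_{i′})⟪u_i,u_{i′}⟫·C(y_k−y_l)⟪u_k,u_l⟫` over the six splittings — two propagators from `x` to the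
legs `i, i′`, the other two legs joined by a line. [cite: GlimmJaffeQP1987, Cor. 8.3.2 (8.3.8)–(8.3.9)] -/
theorem integral_wick2K_mul_four (hK : IsPosSemidefKernel (scalarKernel d N Cv)) (x : ZSite d) (ys : Fin 4 → ZSite d)
    (us : Fin 4 → EuclideanSpace ℝ (Fin N)) :
    ∫ ω, wick2K Cv ω x * (⟪fld ω (ys 0), us 0⟫_ℝ * ⟪fld ω (ys 1), us 1⟫_ℝ * ⟪fld ω (ys 2), us 2⟫_ℝ * ⟪fld ω (ys 3), us 3⟫_ℝ)
        ∂kernelMeasure d N Cv =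
      2 * (Cv (x - ys 0) * Cv (x - ys 1) * ⟪us 0, us 1⟫_ℝ * (Cv (ys 2 - ys 3) * ⟪us 2, us 3⟫_ℝ)
        + Cv (x - ys 0) * Cv (x - ys 2) * ⟪us 0, us 2⟫_ℝ * (Cv (ys 1 - ys 3) * ⟪us 1, us 3⟫_ℝ)
        + Cv (x - ys 0) * Cv (x - ys 3) * ⟪us 0, us 3⟫_ℝ * (Cv (ys 1 - ys 2) * ⟪us 1, us 2⟫_ℝ)
        + Cv (x - ys 1) * Cv (x - ys 2) * ⟪us 1, us 2⟫_ℝ * (Cv (ys 0 - ys 3) * ⟪us 0, us 3⟫_ℝ)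
        + Cv (x - ys 1) * Cv (x - ys 3) * ⟪us 1, us 3⟫_ℝ * (Cv (ys 0 - ys 2) * ⟪us 0, us 2⟫_ℝ)
        + Cv (x - ys 2) * Cv (x - ys 3) * ⟪us 2, us 3⟫_ℝ * (Cv (ys 0 - ys 1) * ⟪us 0, us 1⟫_ℝ)) := by
  have h := integral_wick2K_mul_prod hK x Finset.univ ys us
  simp only [Fin.prod_univ_four] at h
  rw [h, sum_distinct2 (fun i i' => Cv (x - ys i) * Cv (x - ys i') * ⟪us i, us i'⟫_ℝ)
    (fun t => ∫ ω, ∏ j ∈ t, ⟪fld ω (ys j), us j⟫_ℝ ∂kernelMeasure d N Cv)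
    (fun i i' => by rw [real_inner_comm (us i) (us i')]; ring)]
  have hpair : ∀ k l : Fin 4, k ≠ l →
      ∫ ω, ∏ j ∈ ({k, l} : Finset (Fin 4)), ⟪fld ω (ys j), us j⟫_ℝ ∂kernelMeasure d N Cv = Cv (ys k - ys l) * ⟪us k, us l⟫_ℝ := by
    intro k l hkl
    simp_rw [Finset.prod_pair hkl]
    exact integral_inner_fld_inner_fldK hK _ _ _ _
  simp only [hpair 2 3 (by decide), hpair 1 3 (by decide), hpair 1 2 (by decide), hpair 0 3 (by decide),
    hpair 0 2 (by decide), hpair 0 1 (by decide)]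

/-- two legs: `:|φ(x)|²:` times two field insertions is integrable. [cite: Janson1997, Ch. 1 §3, sentence before Thm 1.28] -/
theorem integrable_wick2K_mul_two (hK : IsPosSemidefKernel (scalarKernel d N Cv)) (x y₀ y₁ : ZSite d)
    (u₀ u₁ : EuclideanSpace ℝ (Fin N)) :
    Integrable (fun ω => wick2K Cv ω x * (⟪fld ω y₀, u₀⟫_ℝ * ⟪fld ω y₁, u₁⟫_ℝ)) (kernelMeasure d N Cv) := by
  have h := integrable_wick2K_mul_prod hK x (Finset.univ : Finset (Fin 2)) ![y₀, y₁] ![u₀, u₁]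
  simp only [Fin.prod_univ_two, Matrix.cons_val_zero, Matrix.cons_val_one] at h
  exact h

/-- four legs: `:|φ(x)|²:` times four field insertions is integrable. [cite: Janson1997, Ch. 1 §3, sentence before Thm 1.28] -/
theorem integrable_wick2K_mul_four (hK : IsPosSemidefKernel (scalarKernel d N Cv)) (x : ZSite d) (ys : Fin 4 → ZSite d)
    (us : Fin 4 → EuclideanSpace ℝ (Fin N)) :
    Integrable (fun ω => wick2K Cv ω x *
      (⟪fld ω (ys 0), us 0⟫_ℝ * ⟪fld ω (ys 1), us 1⟫_ℝ * ⟪fld ω (ys 2), us 2⟫_ℝ * ⟪fld ω (ys 3), us 3⟫_ℝ)) (kernelMeasure d N Cv) := by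
  have h := integrable_wick2K_mul_prod hK x (Finset.univ : Finset (Fin 4)) ys us
  simp only [Fin.prod_univ_four] at h
  exact h

end Engine

/-! ## §2 The one-loop pictures with the two-leg vertex at `z` on `ηℤ^d`: opened tadpoles and triangles -/

section Pictures

/-- `:|φ(z)|²:` times a bilinear vertex is integrable. [cite: Janson1997, Ch. 1 §3, sentence before Thm 1.28] -/
theorem integrable_wick2K_mul_biq (hK : IsPosSemidefKernel (scalarKernel d N Cv)) (z y y' : ZSite d)
    (Q : EuclideanSpace ℝ (Fin N) →L[ℝ] EuclideanSpace ℝ (Fin N)) :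
    Integrable (fun ω => wick2K Cv ω z * ⟪fld ω y, Q (fld ω y')⟫_ℝ) (kernelMeasure d N Cv) := by
  have e1 : (fun ω => wick2K Cv ω z * ⟪fld ω y, Q (fld ω y')⟫_ℝ) = fun ω => ∑ i : Fin N, wick2K Cv ω z *
      (⟪fld ω y, EuclideanSpace.basisFun (Fin N) ℝ i⟫_ℝ *
        ⟪fld ω y', (ContinuousLinearMap.adjoint Q) (EuclideanSpace.basisFun (Fin N) ℝ i)⟫_ℝ) := by
    funext ω; rw [biq_expand, Finset.mul_sum]
  rw [e1]
  exact integrable_finsetSum _ fun i _ => integrable_wick2K_mul_two hK z y y' _ _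

/-- **THE TADPOLE OPENED AT `z`**: `∫ :|φ(z)|²:_C ⟪φ(y),Qφ(y′)⟫ dμ_C = 2·C(z−y)C(z−y′)·tr Q` for every operator `Q` — both legs of the
two-leg vertex contracted into the bilinear vertex (the seagulls `⟨φ,B·∂^ηλq²φ⟩`, `⟨∂^ηφ,B∂^ηλq²φ⟩` of (2.26) are sums of such with
`Q = q²`; the torus twin: `B3WT228Phi2Graphs.integral_wick2_biq`). [cite: Balaban1983Higgs3, (2.28) p.431] -/
theorem integral_wick2K_biq (hK : IsPosSemidefKernel (scalarKernel d N Cv)) (z y y' : ZSite d)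
    (Q : EuclideanSpace ℝ (Fin N) →L[ℝ] EuclideanSpace ℝ (Fin N)) :
    ∫ ω, wick2K Cv ω z * ⟪fld ω y, Q (fld ω y')⟫_ℝ ∂kernelMeasure d N Cv = 2 * (Cv (z - y) * Cv (z - y')) * trE Q := by
  simp_rw [biq_expand _ y y' Q, Finset.mul_sum]
  rw [integral_finsetSum _ (fun i _ => integrable_wick2K_mul_two hK z y y' _ _), trE, Finset.mul_sum]
  refine Finset.sum_congr rfl fun i _ => ?_
  rw [integral_wick2K_mul_two hK, ContinuousLinearMap.adjoint_inner_right,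
    real_inner_comm (EuclideanSpace.basisFun (Fin N) ℝ i)]

/-- `:|φ(z)|²:` times two current vertices is integrable. [cite: Janson1997, Ch. 1 §3, sentence before Thm 1.28] -/
theorem integrable_wick2K_mul_JJ (hK : IsPosSemidefKernel (scalarKernel d N Cv)) (z y₁ y₂ y₃ y₄ : ZSite d) :
    Integrable (fun ω => wick2K Cv ω z * (⟪fld ω y₁, C.q (fld ω y₂)⟫_ℝ * ⟪fld ω y₃, C.q (fld ω y₄)⟫_ℝ))
      (kernelMeasure d N Cv) := by
  have e1 : (fun ω => wick2K Cv ω z * (⟪fld ω y₁, C.q (fld ω y₂)⟫_ℝ * ⟪fld ω y₃, C.q (fld ω y₄)⟫_ℝ)) =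
      fun ω => ∑ i : Fin N, ∑ k : Fin N, wick2K Cv ω z *
        (⟪fld ω y₁, EuclideanSpace.basisFun (Fin N) ℝ i⟫_ℝ * ⟪fld ω y₂, C.q (EuclideanSpace.basisFun (Fin N) ℝ i)⟫_ℝ *
          ⟪fld ω y₃, EuclideanSpace.basisFun (Fin N) ℝ k⟫_ℝ * ⟪fld ω y₄, C.q (EuclideanSpace.basisFun (Fin N) ℝ k)⟫_ℝ) := by
    funext ω
    rw [JJ_expand, Finset.mul_sum]
    exact Finset.sum_congr rfl fun i _ => Finset.mul_sum _ _ _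
  rw [e1]
  refine integrable_finsetSum _ fun i _ => integrable_finsetSum _ fun k _ => ?_
  have h := integrable_wick2K_mul_four hK z ![y₁, y₂, y₃, y₄] ![EuclideanSpace.basisFun (Fin N) ℝ i,
    C.q (EuclideanSpace.basisFun (Fin N) ℝ i), EuclideanSpace.basisFun (Fin N) ℝ k, C.q (EuclideanSpace.basisFun (Fin N) ℝ k)]
  simp only [Matrix.cons_val_zero, Matrix.cons_val_one, Matrix.cons_val_two, Matrix.cons_val_three, Matrix.head_cons,
    Matrix.tail_cons] at h
  exact h

/-- **THE TRIANGLES THROUGH `z`** — the two-propagator loop of (2.26) with the two-leg vertex inserted: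
`∫ :|φ(z)|²:_C ⟪φ(y₁),qφ(y₂)⟫⟪φ(y₃),qφ(y₄)⟫ dμ_C
= −2·tr q²·[C(z−y₁)C(z−y₃)C(y₂−y₄) − C(z−y₁)C(z−y₄)C(y₂−y₃) − C(z−y₂)C(z−y₃)C(y₁−y₄) + C(z−y₂)C(z−y₄)C(y₁−y₃)]` — each line of the loop
`tr q²·[C(y₁−y₄)C(y₂−y₃) − C(y₁−y₃)C(y₂−y₄)]` in turn opened at `z`; the splittings with both vertex legs into ONE current vanish
(`⟪e_i,qe_i⟫ = 0`), the others carry the colour traces `Σ⟪e_i,e_k⟫⟪qe_i,qe_k⟫ = −tr q²`, `Σ⟪e_i,qe_k⟫⟪qe_i,e_k⟫ = tr q²` (the torus twin: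
`B3WT228Phi2Graphs.integral_wick2_JJ`). [cite: Balaban1983Higgs3, (2.28) p.431] -/
theorem integral_wick2K_JJ (hK : IsPosSemidefKernel (scalarKernel d N Cv)) (z y₁ y₂ y₃ y₄ : ZSite d) :
    ∫ ω, wick2K Cv ω z * (⟪fld ω y₁, C.q (fld ω y₂)⟫_ℝ * ⟪fld ω y₃, C.q (fld ω y₄)⟫_ℝ) ∂kernelMeasure d N Cv =
      -2 * trE (C.q.comp C.q) *
        (Cv (z - y₁) * Cv (z - y₃) * Cv (y₂ - y₄) - Cv (z - y₁) * Cv (z - y₄) * Cv (y₂ - y₃)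
          - Cv (z - y₂) * Cv (z - y₃) * Cv (y₁ - y₄) + Cv (z - y₂) * Cv (z - y₄) * Cv (y₁ - y₃)) := by
  have hI : ∀ i k : Fin N, Integrable (fun ω => wick2K Cv ω z *
      (⟪fld ω y₁, EuclideanSpace.basisFun (Fin N) ℝ i⟫_ℝ * ⟪fld ω y₂, C.q (EuclideanSpace.basisFun (Fin N) ℝ i)⟫_ℝ *
        ⟪fld ω y₃, EuclideanSpace.basisFun (Fin N) ℝ k⟫_ℝ * ⟪fld ω y₄, C.q (EuclideanSpace.basisFun (Fin N) ℝ k)⟫_ℝ))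
      (kernelMeasure d N Cv) := by
    intro i k
    have h := integrable_wick2K_mul_four hK z ![y₁, y₂, y₃, y₄] ![EuclideanSpace.basisFun (Fin N) ℝ i,
      C.q (EuclideanSpace.basisFun (Fin N) ℝ i), EuclideanSpace.basisFun (Fin N) ℝ k, C.q (EuclideanSpace.basisFun (Fin N) ℝ k)]
    simp only [Matrix.cons_val_zero, Matrix.cons_val_one, Matrix.cons_val_two, Matrix.cons_val_three, Matrix.head_cons,
      Matrix.tail_cons] at h
    exact h
  have hik : ∀ i k : Fin N, ∫ ω, wick2K Cv ω z *
      (⟪fld ω y₁, EuclideanSpace.basisFun (Fin N) ℝ i⟫_ℝ * ⟪fld ω y₂, C.q (EuclideanSpace.basisFun (Fin N) ℝ i)⟫_ℝ *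
        ⟪fld ω y₃, EuclideanSpace.basisFun (Fin N) ℝ k⟫_ℝ * ⟪fld ω y₄, C.q (EuclideanSpace.basisFun (Fin N) ℝ k)⟫_ℝ)
        ∂kernelMeasure d N Cv =
      2 * (Cv (z - y₁) * Cv (z - y₃) * Cv (y₂ - y₄) + Cv (z - y₂) * Cv (z - y₄) * Cv (y₁ - y₃)) *
          (⟪EuclideanSpace.basisFun (Fin N) ℝ i, EuclideanSpace.basisFun (Fin N) ℝ k⟫_ℝ *
            ⟪C.q (EuclideanSpace.basisFun (Fin N) ℝ i), C.q (EuclideanSpace.basisFun (Fin N) ℝ k)⟫_ℝ)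
        + 2 * (Cv (z - y₁) * Cv (z - y₄) * Cv (y₂ - y₃) + Cv (z - y₂) * Cv (z - y₃) * Cv (y₁ - y₄)) *
          (⟪EuclideanSpace.basisFun (Fin N) ℝ i, C.q (EuclideanSpace.basisFun (Fin N) ℝ k)⟫_ℝ *
            ⟪C.q (EuclideanSpace.basisFun (Fin N) ℝ i), EuclideanSpace.basisFun (Fin N) ℝ k⟫_ℝ) := by
    intro i k
    have h := integral_wick2K_mul_four hK z ![y₁, y₂, y₃, y₄] ![EuclideanSpace.basisFun (Fin N) ℝ i,
      C.q (EuclideanSpace.basisFun (Fin N) ℝ i), EuclideanSpace.basisFun (Fin N) ℝ k, C.q (EuclideanSpace.basisFun (Fin N) ℝ k)]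
    simp only [Matrix.cons_val_zero, Matrix.cons_val_one, Matrix.cons_val_two, Matrix.cons_val_three, Matrix.head_cons,
      Matrix.tail_cons] at h
    rw [h, inner_q_self, inner_q_self]
    ring
  have e1 : (fun ω => wick2K Cv ω z * (⟪fld ω y₁, C.q (fld ω y₂)⟫_ℝ * ⟪fld ω y₃, C.q (fld ω y₄)⟫_ℝ)) =
      fun ω => ∑ i : Fin N, ∑ k : Fin N, wick2K Cv ω z *
        (⟪fld ω y₁, EuclideanSpace.basisFun (Fin N) ℝ i⟫_ℝ * ⟪fld ω y₂, C.q (EuclideanSpace.basisFun (Fin N) ℝ i)⟫_ℝ *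
          ⟪fld ω y₃, EuclideanSpace.basisFun (Fin N) ℝ k⟫_ℝ * ⟪fld ω y₄, C.q (EuclideanSpace.basisFun (Fin N) ℝ k)⟫_ℝ) := by
    funext ω
    rw [JJ_expand, Finset.mul_sum]
    exact Finset.sum_congr rfl fun i _ => Finset.mul_sum _ _ _
  rw [e1, integral_finsetSum _ (fun i _ => integrable_finsetSum _ fun k _ => hI i k)]
  rw [Finset.sum_congr rfl fun i _ => (integral_finsetSum _ (fun k _ => hI i k)).trans (Finset.sum_congr rfl fun k _ => hik i k)]
  simp only [Finset.sum_add_distrib, ← Finset.mul_sum]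
  rw [sum_inner_mul_inner_qq C, sum_inner_mul_inner_q_q C]
  ring

end Pictures

/-! ## §3 The identity for `F = :|φ(z)|²:` on `ηℤ^d`: the Gaussian integral evaluated as one-loop graphs, and the graphs summed
to zero by the kernel Ward identity `B3WTKernelWardIdentity.current_insertion_eq` -/

section Identity

/-- `∫ :|φ(z)|²: ⟨∂^ηφ,Bqφ⟩⟨∂^ηφ,∂^ηλqφ⟩ dμ_C = Σ_{b,b′}(η^dB_bη⁻¹)(η^d(∂^ηλ)(b′)η⁻¹)·∫ :|φ(z)|²: J(b₋,b₊)J(b′₋,b′₊) dμ_C` — the sum over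
the positions of the two current vertices. [cite: Balaban1983Higgs3, (2.28) p.431] -/
theorem integral_wick2K_curJ_pairD_expand (hK : IsPosSemidefKernel (scalarKernel d N Cv)) (z : ZSite d) (S : Finset (ZSite d))
    (B : ZSite d → Fin d → ℝ) (lam : ZSite d → ℝ) :
    ∫ ω, wick2K Cv ω z * (curJ C η S B ω * pairD C η S lam ω) ∂kernelMeasure d N Cv =
      ∑ y ∈ S, ∑ μ : Fin d, ∑ y' ∈ S, ∑ ν : Fin d,
        (η ^ d * B y μ * η⁻¹) * (η ^ d * pdiffZ η⁻¹ ν lam y' * η⁻¹) *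
          ∫ ω, wick2K Cv ω z * (⟪fld ω y, C.q (fld ω (y + unitVec μ))⟫_ℝ * ⟪fld ω y', C.q (fld ω (y' + unitVec ν))⟫_ℝ)
            ∂kernelMeasure d N Cv := by
  have e1 : (fun ω => wick2K Cv ω z * (curJ C η S B ω * pairD C η S lam ω)) = fun ω =>
      ∑ y ∈ S, ∑ μ : Fin d, ∑ y' ∈ S, ∑ ν : Fin d, (η ^ d * B y μ * η⁻¹) * (η ^ d * pdiffZ η⁻¹ ν lam y' * η⁻¹) *
        (wick2K Cv ω z * (⟪fld ω y, C.q (fld ω (y + unitVec μ))⟫_ℝ * ⟪fld ω y', C.q (fld ω (y' + unitVec ν))⟫_ℝ)) := by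
    funext ω
    rw [curJ_mul_pairD_expand, Finset.mul_sum]
    refine Finset.sum_congr rfl fun y _ => ?_
    rw [Finset.mul_sum]
    refine Finset.sum_congr rfl fun μ _ => ?_
    rw [Finset.mul_sum]
    refine Finset.sum_congr rfl fun y' _ => ?_
    rw [Finset.mul_sum]
    exact Finset.sum_congr rfl fun ν _ => by ring
  have hi : ∀ (y : ZSite d) (μ : Fin d) (y' : ZSite d) (ν : Fin d), Integrable (fun ω =>
      (η ^ d * B y μ * η⁻¹) * (η ^ d * pdiffZ η⁻¹ ν lam y' * η⁻¹) *
        (wick2K Cv ω z * (⟪fld ω y, C.q (fld ω (y + unitVec μ))⟫_ℝ * ⟪fld ω y', C.q (fld ω (y' + unitVec ν))⟫_ℝ)))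
      (kernelMeasure d N Cv) := fun y μ y' ν => (integrable_wick2K_mul_JJ C hK z _ _ _ _).const_mul _
  rw [e1, integral_finsetSum _ (fun y _ => integrable_finsetSum _ fun μ _ => integrable_finsetSum _ fun y' _ =>
    integrable_finsetSum _ fun ν _ => hi y μ y' ν)]
  refine Finset.sum_congr rfl fun y _ => ?_
  rw [integral_finsetSum _ (fun μ _ => integrable_finsetSum _ fun y' _ => integrable_finsetSum _ fun ν _ => hi y μ y' ν)]
  refine Finset.sum_congr rfl fun μ _ => ?_
  rw [integral_finsetSum _ (fun y' _ => integrable_finsetSum _ fun ν _ => hi y μ y' ν)]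
  refine Finset.sum_congr rfl fun y' _ => ?_
  rw [integral_finsetSum _ (fun ν _ => hi y μ y' ν)]
  exact Finset.sum_congr rfl fun ν _ => integral_const_mul _ _

/-- integrability of `:|φ(z)|²: ⟨∂^ηφ,Bqφ⟩⟨∂^ηφ,∂^ηλqφ⟩`. [cite: Balaban1983Higgs3, (2.28) p.431] -/
theorem integrable_wick2K_curJ_pairD (hK : IsPosSemidefKernel (scalarKernel d N Cv)) (z : ZSite d) (S : Finset (ZSite d))
    (B : ZSite d → Fin d → ℝ) (lam : ZSite d → ℝ) :
    Integrable (fun ω => wick2K Cv ω z * (curJ C η S B ω * pairD C η S lam ω)) (kernelMeasure d N Cv) := by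
  have e1 : (fun ω => wick2K Cv ω z * (curJ C η S B ω * pairD C η S lam ω)) = fun ω =>
      ∑ y ∈ S, ∑ μ : Fin d, ∑ y' ∈ S, ∑ ν : Fin d, (η ^ d * B y μ * η⁻¹) * (η ^ d * pdiffZ η⁻¹ ν lam y' * η⁻¹) *
        (wick2K Cv ω z * (⟪fld ω y, C.q (fld ω (y + unitVec μ))⟫_ℝ * ⟪fld ω y', C.q (fld ω (y' + unitVec ν))⟫_ℝ)) := by
    funext ω
    rw [curJ_mul_pairD_expand, Finset.mul_sum]
    refine Finset.sum_congr rfl fun y _ => ?_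
    rw [Finset.mul_sum]
    refine Finset.sum_congr rfl fun μ _ => ?_
    rw [Finset.mul_sum]
    refine Finset.sum_congr rfl fun y' _ => ?_
    rw [Finset.mul_sum]
    exact Finset.sum_congr rfl fun ν _ => by ring
  rw [e1]
  exact integrable_finsetSum _ fun y _ => integrable_finsetSum _ fun μ _ => integrable_finsetSum _ fun y' _ =>
    integrable_finsetSum _ fun ν _ => (integrable_wick2K_mul_JJ C hK z _ _ _ _).const_mul _

/-- **the triangles summed over the two current vertices**: `∫ :|φ(z)|²: ⟨∂^ηφ,Bqφ⟩⟨∂^ηφ,∂^ηλqφ⟩ dμ_C =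
Σ_{b,b′}(η^dB_bη⁻¹)(η^d(∂^ηλ)(b′)η⁻¹)·(−2tr q²)[C(z−b₋)C(z−b′₋)C(b₊−b′₊) − C(z−b₋)C(z−b′₊)C(b₊−b′₋) − C(z−b₊)C(z−b′₋)C(b₋−b′₊)
+ C(z−b₊)C(z−b′₊)C(b₋−b′₋)]`. [cite: Balaban1983Higgs3, (2.28) p.431] -/
theorem integral_wick2K_curJ_pairD (hK : IsPosSemidefKernel (scalarKernel d N Cv)) (z : ZSite d) (S : Finset (ZSite d))
    (B : ZSite d → Fin d → ℝ) (lam : ZSite d → ℝ) :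
    ∫ ω, wick2K Cv ω z * (curJ C η S B ω * pairD C η S lam ω) ∂kernelMeasure d N Cv =
      ∑ y ∈ S, ∑ μ : Fin d, ∑ y' ∈ S, ∑ ν : Fin d,
        (η ^ d * B y μ * η⁻¹) * (η ^ d * pdiffZ η⁻¹ ν lam y' * η⁻¹) *
          (-2 * trE (C.q.comp C.q) *
            (Cv (z - y) * Cv (z - y') * Cv (y + unitVec μ - (y' + unitVec ν))
              - Cv (z - y) * Cv (z - (y' + unitVec ν)) * Cv (y + unitVec μ - y')
              - Cv (z - (y + unitVec μ)) * Cv (z - y') * Cv (y - (y' + unitVec ν))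
              + Cv (z - (y + unitVec μ)) * Cv (z - (y' + unitVec ν)) * Cv (y - y'))) := by
  rw [integral_wick2K_curJ_pairD_expand C η hK]
  exact Finset.sum_congr rfl fun y _ => Finset.sum_congr rfl fun μ _ => Finset.sum_congr rfl fun y' _ =>
    Finset.sum_congr rfl fun ν _ => by rw [integral_wick2K_JJ C hK]

/-- **the opened tadpole of the third (2.27) picture**: `∫ :|φ(z)|²: ⟨φ,B·∂^ηλq²φ⟩ dμ_C = Σ_bη^dB_b(∂^ηλ)(b)·2C(z−b₋)²·tr q²`.
[cite: Balaban1983Higgs3, (2.28) p.431] -/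
theorem integral_wick2K_locQ (hK : IsPosSemidefKernel (scalarKernel d N Cv)) (z : ZSite d) (S : Finset (ZSite d))
    (B : ZSite d → Fin d → ℝ) (lam : ZSite d → ℝ) :
    ∫ ω, wick2K Cv ω z * locQ C η S B lam ω ∂kernelMeasure d N Cv =
      ∑ y ∈ S, ∑ μ : Fin d, (η ^ d * (B y μ * pdiffZ η⁻¹ μ lam y)) * (2 * (Cv (z - y) * Cv (z - y)) * trE (C.q.comp C.q)) := by
  have e1 : (fun ω => wick2K Cv ω z * locQ C η S B lam ω) = fun ω => ∑ y ∈ S, ∑ μ : Fin d,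
      (η ^ d * (B y μ * pdiffZ η⁻¹ μ lam y)) * (wick2K Cv ω z * ⟪fld ω y, (C.q.comp C.q) (fld ω y)⟫_ℝ) := by
    funext ω
    unfold locQ
    rw [Finset.mul_sum]
    refine Finset.sum_congr rfl fun y _ => ?_
    rw [Finset.mul_sum]
    exact Finset.sum_congr rfl fun μ _ => by rw [ContinuousLinearMap.comp_apply]; ring
  have hi : ∀ (y : ZSite d) (μ : Fin d), Integrable (fun ω =>
      (η ^ d * (B y μ * pdiffZ η⁻¹ μ lam y)) * (wick2K Cv ω z * ⟪fld ω y, (C.q.comp C.q) (fld ω y)⟫_ℝ)) (kernelMeasure d N Cv) :=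
    fun y μ => (integrable_wick2K_mul_biq hK z y y _).const_mul _
  rw [e1, integral_finsetSum _ (fun y _ => integrable_finsetSum _ fun μ _ => hi y μ)]
  refine Finset.sum_congr rfl fun y _ => ?_
  rw [integral_finsetSum _ (fun μ _ => hi y μ)]
  exact Finset.sum_congr rfl fun μ _ => by rw [integral_const_mul, integral_wick2K_biq hK]

/-- integrability of `:|φ(z)|²: ⟨φ,B·∂^ηλq²φ⟩`. [cite: Balaban1983Higgs3, (2.28) p.431] -/
theorem integrable_wick2K_locQ (hK : IsPosSemidefKernel (scalarKernel d N Cv)) (z : ZSite d) (S : Finset (ZSite d))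
    (B : ZSite d → Fin d → ℝ) (lam : ZSite d → ℝ) :
    Integrable (fun ω => wick2K Cv ω z * locQ C η S B lam ω) (kernelMeasure d N Cv) := by
  have e1 : (fun ω => wick2K Cv ω z * locQ C η S B lam ω) = fun ω => ∑ y ∈ S, ∑ μ : Fin d,
      (η ^ d * (B y μ * pdiffZ η⁻¹ μ lam y)) * (wick2K Cv ω z * ⟪fld ω y, (C.q.comp C.q) (fld ω y)⟫_ℝ) := by
    funext ω
    unfold locQ
    rw [Finset.mul_sum]
    refine Finset.sum_congr rfl fun y _ => ?_
    rw [Finset.mul_sum]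
    exact Finset.sum_congr rfl fun μ _ => by rw [ContinuousLinearMap.comp_apply]; ring
  rw [e1]
  exact integrable_finsetSum _ fun y _ => integrable_finsetSum _ fun μ _ => (integrable_wick2K_mul_biq hK z y y _).const_mul _

/-- **the opened tadpole of the fourth (2.27) picture**: `∫ :|φ(z)|²: ⟨∂^ηφ,B∂^ηλq²φ⟩ dμ_C =
Σ_bη^dB_b(∂^ηλ)(b)η⁻¹·2tr q²·[C(z−b₊)C(z−b₋) − C(z−b₋)²]`. [cite: Balaban1983Higgs3, (2.28) p.431] -/
theorem integral_wick2K_derQ (hK : IsPosSemidefKernel (scalarKernel d N Cv)) (z : ZSite d) (S : Finset (ZSite d))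
    (B : ZSite d → Fin d → ℝ) (lam : ZSite d → ℝ) :
    ∫ ω, wick2K Cv ω z * derQ C η S B lam ω ∂kernelMeasure d N Cv = ∑ y ∈ S, ∑ μ : Fin d,
      ((η ^ d * (B y μ * pdiffZ η⁻¹ μ lam y) * η⁻¹) * (2 * (Cv (z - (y + unitVec μ)) * Cv (z - y)) * trE (C.q.comp C.q))
        - (η ^ d * (B y μ * pdiffZ η⁻¹ μ lam y) * η⁻¹) * (2 * (Cv (z - y) * Cv (z - y)) * trE (C.q.comp C.q))) := by
  have e1 : (fun ω => wick2K Cv ω z * derQ C η S B lam ω) = fun ω => ∑ y ∈ S, ∑ μ : Fin d,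
      ((η ^ d * (B y μ * pdiffZ η⁻¹ μ lam y) * η⁻¹) * (wick2K Cv ω z * ⟪fld ω (y + unitVec μ), (C.q.comp C.q) (fld ω y)⟫_ℝ)
        - (η ^ d * (B y μ * pdiffZ η⁻¹ μ lam y) * η⁻¹) * (wick2K Cv ω z * ⟪fld ω y, (C.q.comp C.q) (fld ω y)⟫_ℝ)) := by
    funext ω
    rw [derQ_expand, Finset.mul_sum]
    refine Finset.sum_congr rfl fun y _ => ?_
    rw [Finset.mul_sum]
    exact Finset.sum_congr rfl fun μ _ => by simp only [ContinuousLinearMap.comp_apply]; ring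
  have hi1 : ∀ (y : ZSite d) (μ : Fin d), Integrable (fun ω => (η ^ d * (B y μ * pdiffZ η⁻¹ μ lam y) * η⁻¹) *
      (wick2K Cv ω z * ⟪fld ω (y + unitVec μ), (C.q.comp C.q) (fld ω y)⟫_ℝ)) (kernelMeasure d N Cv) :=
    fun y μ => (integrable_wick2K_mul_biq hK z _ _ _).const_mul _
  have hi2 : ∀ (y : ZSite d) (μ : Fin d), Integrable (fun ω => (η ^ d * (B y μ * pdiffZ η⁻¹ μ lam y) * η⁻¹) *
      (wick2K Cv ω z * ⟪fld ω y, (C.q.comp C.q) (fld ω y)⟫_ℝ)) (kernelMeasure d N Cv) :=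
    fun y μ => (integrable_wick2K_mul_biq hK z _ _ _).const_mul _
  have hi : ∀ (y : ZSite d) (μ : Fin d), Integrable (fun ω =>
      (η ^ d * (B y μ * pdiffZ η⁻¹ μ lam y) * η⁻¹) * (wick2K Cv ω z * ⟪fld ω (y + unitVec μ), (C.q.comp C.q) (fld ω y)⟫_ℝ)
        - (η ^ d * (B y μ * pdiffZ η⁻¹ μ lam y) * η⁻¹) * (wick2K Cv ω z * ⟪fld ω y, (C.q.comp C.q) (fld ω y)⟫_ℝ))
      (kernelMeasure d N Cv) := fun y μ => (hi1 y μ).sub (hi2 y μ)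
  rw [e1, integral_finsetSum _ (fun y _ => integrable_finsetSum _ fun μ _ => hi y μ)]
  refine Finset.sum_congr rfl fun y _ => ?_
  rw [integral_finsetSum _ (fun μ _ => hi y μ)]
  exact Finset.sum_congr rfl fun μ _ => by
    rw [integral_sub (hi1 y μ) (hi2 y μ), integral_const_mul, integral_const_mul, integral_wick2K_biq hK,
      integral_wick2K_biq hK]

/-- integrability of `:|φ(z)|²: ⟨∂^ηφ,B∂^ηλq²φ⟩`. [cite: Balaban1983Higgs3, (2.28) p.431] -/
theorem integrable_wick2K_derQ (hK : IsPosSemidefKernel (scalarKernel d N Cv)) (z : ZSite d) (S : Finset (ZSite d))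
    (B : ZSite d → Fin d → ℝ) (lam : ZSite d → ℝ) :
    Integrable (fun ω => wick2K Cv ω z * derQ C η S B lam ω) (kernelMeasure d N Cv) := by
  have e1 : (fun ω => wick2K Cv ω z * derQ C η S B lam ω) = fun ω => ∑ y ∈ S, ∑ μ : Fin d,
      ((η ^ d * (B y μ * pdiffZ η⁻¹ μ lam y) * η⁻¹) * (wick2K Cv ω z * ⟪fld ω (y + unitVec μ), (C.q.comp C.q) (fld ω y)⟫_ℝ)
        - (η ^ d * (B y μ * pdiffZ η⁻¹ μ lam y) * η⁻¹) * (wick2K Cv ω z * ⟪fld ω y, (C.q.comp C.q) (fld ω y)⟫_ℝ)) := by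
    funext ω
    rw [derQ_expand, Finset.mul_sum]
    refine Finset.sum_congr rfl fun y _ => ?_
    rw [Finset.mul_sum]
    exact Finset.sum_congr rfl fun μ _ => by simp only [ContinuousLinearMap.comp_apply]; ring
  rw [e1]
  exact integrable_finsetSum _ fun y _ => integrable_finsetSum _ fun μ _ =>
    ((integrable_wick2K_mul_biq hK z _ _ _).const_mul _).sub ((integrable_wick2K_mul_biq hK z _ _ _).const_mul _)

/-- the integrand for `F = :|φ(z)|²:` split pairing by pairing (`:⟨∂^ηφ,∂^ηλqφ⟩: = ⟨∂^ηφ,∂^ηλqφ⟩` under `dμ_C` by (2.25),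
`B3WT226FreeGaussian.normOrd_pairDK`). [cite: Balaban1983Higgs3, (2.28) p.431] -/
theorem phi2_integrand_splitK (hK : IsPosSemidefKernel (scalarKernel d N Cv)) (z : ZSite d) (S : Finset (ZSite d))
    (B : ZSite d → Fin d → ℝ) (lam : ZSite d → ℝ) (ω : Cfg d N) :
    wick2K Cv ω z * integrand226 C η (kernelMeasure d N Cv) S B lam ω =
      -C.e * (wick2K Cv ω z * (curJ C η S B ω * pairD C η S lam ω)) - C.e * (wick2K Cv ω z * locQ C η S B lam ω)
        - (η * C.e) * (wick2K Cv ω z * derQ C η S B lam ω) := by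
  rw [integrand226, normOrd_pairDK C η hK]
  ring

/-- integrability of `:|φ(z)|²:` times the printed integrand. [cite: Balaban1983Higgs3, (2.28) p.431] -/
theorem integrable_wick2K_integrand (hK : IsPosSemidefKernel (scalarKernel d N Cv)) (z : ZSite d) (S : Finset (ZSite d))
    (B : ZSite d → Fin d → ℝ) (lam : ZSite d → ℝ) :
    Integrable (fun ω => wick2K Cv ω z * integrand226 C η (kernelMeasure d N Cv) S B lam ω) (kernelMeasure d N Cv) := by
  simp_rw [phi2_integrand_splitK C η hK]
  exact ((((integrable_wick2K_curJ_pairD C η hK z S B lam).const_mul _).sub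
    ((integrable_wick2K_locQ C η hK z S B lam).const_mul _)).sub ((integrable_wick2K_derQ C η hK z S B lam).const_mul _))

/-- **THE GAUSSIAN INTEGRAL FOR `F = :|φ(z)|²:` ON `ηℤ^d` EVALUATED AS ONE-LOOP GRAPHS** — for the Gaussian field `dμ_C` of every
positive semidefinite colour-diagonal kernel: `∫dμ_C :|φ(z)|²:·[(−e⟨∂^ηφ,Bqφ⟩)(:⟨∂^ηφ,∂^ηλqφ⟩:) − e⟨φ,B·∂^ηλq²φ⟩ − ηe⟨∂^ηφ,B∂^ηλq²φ⟩]`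
`= −e Σ_{b,b′}(η^dB_bη⁻¹)(η^d(∂^ηλ)(b′)η⁻¹)(−2tr q²)[C(z−b₋)C(z−b′₋)C(b₊−b′₊) − C(z−b₋)C(z−b′₊)C(b₊−b′₋) − C(z−b₊)C(z−b′₋)C(b₋−b′₊) + C(z−b₊)C(z−b′₊)C(b₋−b′₋)]`
(triangles through `z`) `− e Σ_bη^dB_b(∂^ηλ)(b)·2C(z−b₋)²tr q² − ηe Σ_bη^dB_b(∂^ηλ)(b)η⁻¹·2tr q²[C(z−b₊)C(z−b₋) − C(z−b₋)²]` (opened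
tadpoles) — the `ηℤ^d` transcription of `B3WT228Phi2Graphs.eq228_phi2_wick`. [cite: Balaban1983Higgs3, (2.28) p.431] -/
theorem eq_phi2_wickK (hK : IsPosSemidefKernel (scalarKernel d N Cv)) (z : ZSite d) (S : Finset (ZSite d))
    (B : ZSite d → Fin d → ℝ) (lam : ZSite d → ℝ) :
    ∫ ω, wick2K Cv ω z * integrand226 C η (kernelMeasure d N Cv) S B lam ω ∂kernelMeasure d N Cv =
      -C.e * ∑ y ∈ S, ∑ μ : Fin d, ∑ y' ∈ S, ∑ ν : Fin d,
          (η ^ d * B y μ * η⁻¹) * (η ^ d * pdiffZ η⁻¹ ν lam y' * η⁻¹) *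
            (-2 * trE (C.q.comp C.q) *
              (Cv (z - y) * Cv (z - y') * Cv (y + unitVec μ - (y' + unitVec ν))
                - Cv (z - y) * Cv (z - (y' + unitVec ν)) * Cv (y + unitVec μ - y')
                - Cv (z - (y + unitVec μ)) * Cv (z - y') * Cv (y - (y' + unitVec ν))
                + Cv (z - (y + unitVec μ)) * Cv (z - (y' + unitVec ν)) * Cv (y - y')))
        - C.e * ∑ y ∈ S, ∑ μ : Fin d, (η ^ d * (B y μ * pdiffZ η⁻¹ μ lam y)) * (2 * (Cv (z - y) * Cv (z - y)) * trE (C.q.comp C.q))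
        - (η * C.e) * ∑ y ∈ S, ∑ μ : Fin d,
          ((η ^ d * (B y μ * pdiffZ η⁻¹ μ lam y) * η⁻¹) * (2 * (Cv (z - (y + unitVec μ)) * Cv (z - y)) * trE (C.q.comp C.q))
            - (η ^ d * (B y μ * pdiffZ η⁻¹ μ lam y) * η⁻¹) * (2 * (Cv (z - y) * Cv (z - y)) * trE (C.q.comp C.q))) := by
  have i1 := integrable_wick2K_curJ_pairD C η hK z S B lam
  have i2 := integrable_wick2K_locQ C η hK z S B lam
  have i3 := integrable_wick2K_derQ C η hK z S B lam
  simp_rw [phi2_integrand_splitK C η hK]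
  have j12 : Integrable (fun ω =>
      -C.e * (wick2K Cv ω z * (curJ C η S B ω * pairD C η S lam ω)) - C.e * (wick2K Cv ω z * locQ C η S B lam ω))
      (kernelMeasure d N Cv) := (i1.const_mul _).sub (i2.const_mul _)
  rw [integral_sub j12 (i3.const_mul _), integral_sub (i1.const_mul _) (i2.const_mul _), integral_const_mul,
    integral_const_mul, integral_const_mul, integral_wick2K_curJ_pairD C η hK, integral_wick2K_locQ C η hK,
    integral_wick2K_derQ C η hK]

variable {η}

/-- **THE KERNEL WARD IDENTITY SUMS THE GRAPHS TO ZERO** — for `η ≠ 0`, every EVEN kernel `C` solving the lattice equation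
`(−Δ^η + M²)C = η^{−d}δ` on `ℤ^d`, every gauge function `λ` supported in a finite `T` and every window `S ⊇ T ∪ ⋃_ν(T − e_ν)` carrying
the bonds of `B` and of `∂^ηλ`: the one-loop graphs of `eq_phi2_wickK` sum to `0` at every site `z`. Mechanism: for each bond `b` the
`b′`-sum of the four triangles is `(η^dη⁻¹)(−2tr q²)[C(z−b₋)Φ(z,b₊) − C(z−b₊)Φ(z,b₋)]` with `Φ` the current insertion of
`B3WTKernelWardIdentity.current_insertion_eq`, `= η^dη⁻¹(−2tr q²)·η^{2−d}C(z−b₋)C(z−b₊)(∂^ηλ)(b)`, which the two opened tadpoles at `b`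
cancel exactly (the torus twin `B3WT228Phi2Graphs.eq228_phi2` gets the same zero from the gauge covariance (2.24) instead).
[cite: Balaban1983Higgs3, (2.28) p.431] -/
theorem phi2Graphs_eq_zeroK (hη : η ≠ 0) (hCeven : ∀ z, Cv (-z) = Cv z)
    (hCeq : ∀ z, negLapZ η Cv z + M2 * Cv z = if z = 0 then η⁻¹ ^ d else 0) {T S : Finset (ZSite d)} {lam : ZSite d → ℝ}
    (hT : ∀ x, x ∉ T → lam x = 0) (hTS : T ⊆ S) (hTS' : ∀ ν : Fin d, ∀ x ∈ T, x - unitVec ν ∈ S) (z : ZSite d)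
    (B : ZSite d → Fin d → ℝ) :
    -C.e * ∑ y ∈ S, ∑ μ : Fin d, ∑ y' ∈ S, ∑ ν : Fin d,
          (η ^ d * B y μ * η⁻¹) * (η ^ d * pdiffZ η⁻¹ ν lam y' * η⁻¹) *
            (-2 * trE (C.q.comp C.q) *
              (Cv (z - y) * Cv (z - y') * Cv (y + unitVec μ - (y' + unitVec ν))
                - Cv (z - y) * Cv (z - (y' + unitVec ν)) * Cv (y + unitVec μ - y')
                - Cv (z - (y + unitVec μ)) * Cv (z - y') * Cv (y - (y' + unitVec ν))
                + Cv (z - (y + unitVec μ)) * Cv (z - (y' + unitVec ν)) * Cv (y - y')))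
        - C.e * ∑ y ∈ S, ∑ μ : Fin d, (η ^ d * (B y μ * pdiffZ η⁻¹ μ lam y)) * (2 * (Cv (z - y) * Cv (z - y)) * trE (C.q.comp C.q))
        - (η * C.e) * ∑ y ∈ S, ∑ μ : Fin d,
          ((η ^ d * (B y μ * pdiffZ η⁻¹ μ lam y) * η⁻¹) * (2 * (Cv (z - (y + unitVec μ)) * Cv (z - y)) * trE (C.q.comp C.q))
            - (η ^ d * (B y μ * pdiffZ η⁻¹ μ lam y) * η⁻¹) * (2 * (Cv (z - y) * Cv (z - y)) * trE (C.q.comp C.q))) = 0 := by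
  have hsym : ∀ a b : ZSite d, Cv (a - b) = Cv (b - a) := fun a b => by rw [← hCeven, neg_sub]
  -- the `b′`-sum of the triangles at the bond `b = (y, μ)` by the kernel Ward identity
  have hΦ := fun v => current_insertion_eq hη hCeq hT hTS hTS' z v
  have htri : ∀ (y : ZSite d) (μ : Fin d), ∑ y' ∈ S, ∑ ν : Fin d,
      (η ^ d * B y μ * η⁻¹) * (η ^ d * pdiffZ η⁻¹ ν lam y' * η⁻¹) *
        (-2 * trE (C.q.comp C.q) *
          (Cv (z - y) * Cv (z - y') * Cv (y + unitVec μ - (y' + unitVec ν))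
            - Cv (z - y) * Cv (z - (y' + unitVec ν)) * Cv (y + unitVec μ - y')
            - Cv (z - (y + unitVec μ)) * Cv (z - y') * Cv (y - (y' + unitVec ν))
            + Cv (z - (y + unitVec μ)) * Cv (z - (y' + unitVec ν)) * Cv (y - y'))) =
      (η ^ d * B y μ * η⁻¹) * (η ^ d * η⁻¹) * (-2 * trE (C.q.comp C.q)) *
        (Cv (z - y) * (η * η⁻¹ ^ d * (Cv (z - (y + unitVec μ)) * (lam (y + unitVec μ) - lam z)))
          - Cv (z - (y + unitVec μ)) * (η * η⁻¹ ^ d * (Cv (z - y) * (lam y - lam z)))) := by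
    intro y μ
    rw [← hΦ (y + unitVec μ), ← hΦ y, Finset.mul_sum, Finset.mul_sum, ← Finset.sum_sub_distrib, Finset.mul_sum]
    refine Finset.sum_congr rfl fun y' _ => ?_
    rw [Finset.mul_sum, Finset.mul_sum, ← Finset.sum_sub_distrib, Finset.mul_sum]
    refine Finset.sum_congr rfl fun ν _ => ?_
    rw [hsym (y + unitVec μ) (y' + unitVec ν), hsym (y + unitVec μ) y', hsym y (y' + unitVec ν), hsym y y']
    ring
  rw [Finset.sum_congr rfl fun y _ => Finset.sum_congr rfl fun μ _ => htri y μ, Finset.mul_sum, Finset.mul_sum,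
    Finset.mul_sum, ← Finset.sum_sub_distrib, ← Finset.sum_sub_distrib]
  refine Finset.sum_eq_zero fun y _ => ?_
  rw [Finset.mul_sum, Finset.mul_sum, Finset.mul_sum, ← Finset.sum_sub_distrib, ← Finset.sum_sub_distrib]
  refine Finset.sum_eq_zero fun μ _ => ?_
  simp only [pdiffZ, inv_pow]
  field_simp
  ring

/-- **THE WARD–TAKAHASHI IDENTITY FOR `F = :|φ(z)|²:` ON `ηℤ^d`** — *"Taking other functions F … we can get all necessary
Ward-Takahashi identities. They hold for free boundary conditions also"* — for the Gaussian field `dμ_C` of every positive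
semidefinite, even kernel `δ_{ab}C(x − y)` solving `(−Δ^η + M²)C = η^{−d}δ` (`η ≠ 0`), every site `z`, every gauge function `λ` supported in a
finite `T`, every window `S ⊇ T ∪ ⋃_ν(T − e_ν)` and every external field `B` on its bonds:
`∫dμ_C :|φ(z)|²:_C·[(−e⟨∂^ηφ,Bqφ⟩)(:⟨∂^ηφ,∂^ηλqφ⟩:) − e⟨φ,B·∂^ηλq²φ⟩ − ηe⟨∂^ηφ,B∂^ηλq²φ⟩] = 0`. [cite: Balaban1983Higgs3, (2.28) p.431] -/
theorem eq_phi2_kernel (hK : IsPosSemidefKernel (scalarKernel d N Cv)) (hη : η ≠ 0) (hCeven : ∀ z, Cv (-z) = Cv z)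
    (hCeq : ∀ z, negLapZ η Cv z + M2 * Cv z = if z = 0 then η⁻¹ ^ d else 0) {T S : Finset (ZSite d)} {lam : ZSite d → ℝ}
    (hT : ∀ x, x ∉ T → lam x = 0) (hTS : T ⊆ S) (hTS' : ∀ ν : Fin d, ∀ x ∈ T, x - unitVec ν ∈ S) (z : ZSite d)
    (B : ZSite d → Fin d → ℝ) :
    ∫ ω, wick2K Cv ω z * integrand226 C η (kernelMeasure d N Cv) S B lam ω ∂kernelMeasure d N Cv = 0 := by
  rw [eq_phi2_wickK C η hK, phi2Graphs_eq_zeroK C hη hCeven hCeq hT hTS hTS']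

/-- **… and for the weighted sums `F = Σ_{z∈Δ}η^dβ(z):|φ(z)|²:`** (the print's `F = −½Σ_xδm²_l(x):|φ(x)|²:` and
`−λ_kC^η_{M²}(0)Σ_x:|φ(x)|²:` of p. 430). [cite: Balaban1983Higgs3, (2.24) p.430 (the admissible F)] -/
theorem eq_phi2_kernel_weighted (hK : IsPosSemidefKernel (scalarKernel d N Cv)) (hη : η ≠ 0) (hCeven : ∀ z, Cv (-z) = Cv z)
    (hCeq : ∀ z, negLapZ η Cv z + M2 * Cv z = if z = 0 then η⁻¹ ^ d else 0) {T S : Finset (ZSite d)} {lam : ZSite d → ℝ}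
    (hT : ∀ x, x ∉ T → lam x = 0) (hTS : T ⊆ S) (hTS' : ∀ ν : Fin d, ∀ x ∈ T, x - unitVec ν ∈ S) (Δ : Finset (ZSite d))
    (β : ZSite d → ℝ) (B : ZSite d → Fin d → ℝ) :
    ∫ ω, (∑ z ∈ Δ, η ^ d * (β z * wick2K Cv ω z)) * integrand226 C η (kernelMeasure d N Cv) S B lam ω
      ∂kernelMeasure d N Cv = 0 := by
  have e1 : (fun ω => (∑ z ∈ Δ, η ^ d * (β z * wick2K Cv ω z)) * integrand226 C η (kernelMeasure d N Cv) S B lam ω) =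
      fun ω => ∑ z ∈ Δ, (η ^ d * β z) * (wick2K Cv ω z * integrand226 C η (kernelMeasure d N Cv) S B lam ω) := by
    funext ω
    rw [Finset.sum_mul]
    exact Finset.sum_congr rfl fun z _ => by ring
  rw [e1, integral_finsetSum _ (fun z _ => (integrable_wick2K_integrand C η hK z S B lam).const_mul _)]
  exact Finset.sum_eq_zero fun z _ => by
    rw [integral_const_mul, eq_phi2_kernel C hK hη hCeven hCeq hT hTS hTS', mul_zero]

/-- **AT FREE BOUNDARY CONDITIONS** — the instance `C = C^η_{M²}` (`η > 0`, `M² > 0`) of the infinite lattice `ηℤ^d`, the measure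
`dμ_{C^η_{M²}}` of `B3WTFreeMeasure`: for every site `z`, every `λ` supported in a finite `T`, window `S ⊇ T ∪ ⋃_ν(T − e_ν)`, and `B`,
`∫dμ_{C^η_{M²}} :|φ(z)|²:·[(−e⟨∂^ηφ,Bqφ⟩)(:⟨∂^ηφ,∂^ηλqφ⟩:) − e⟨φ,B·∂^ηλq²φ⟩ − ηe⟨∂^ηφ,B∂^ηλq²φ⟩] = 0` — the `F = :|φ(z)|²:` identity
*"for free boundary conditions"*, proved directly on `ηℤ^d` (no periodic limit). [cite: Balaban1983Higgs3, (2.28) p.431] -/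
theorem eq_phi2_free (hη : 0 < η) (hM : 0 < M2) {T S : Finset (ZSite d)} {lam : ZSite d → ℝ} (hT : ∀ x, x ∉ T → lam x = 0)
    (hTS : T ⊆ S) (hTS' : ∀ ν : Fin d, ∀ x ∈ T, x - unitVec ν ∈ S) (z : ZSite d) (B : ZSite d → Fin d → ℝ) :
    ∫ ω, wick2K (CetaM d η M2) ω z * integrand226 C η (freeMeasure d N η M2) S B lam ω ∂freeMeasure d N η M2 = 0 :=
  eq_phi2_kernel C (Cv := CetaM d η M2) (isPosSemidefKernel_freeKernel hη hM) hη.ne' CetaM_neg (negLapZ_CetaM_add hη hM)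
    hT hTS hTS' z B

/-- the same with the canonical window `S = dSupp T` (`T` and its backward neighbours) of `B3WT226PeriodicLimit`.
[cite: Balaban1983Higgs3, (2.28) p.431] -/
theorem eq_phi2_free_dSupp (hη : 0 < η) (hM : 0 < M2) {T : Finset (ZSite d)} {lam : ZSite d → ℝ}
    (hT : ∀ x ∉ T, lam x = 0) (z : ZSite d) (B : ZSite d → Fin d → ℝ) :
    ∫ ω, wick2K (CetaM d η M2) ω z * integrand226 C η (freeMeasure d N η M2) (dSupp T) B lam ω ∂freeMeasure d N η M2 = 0 :=
  eq_phi2_free C hη hM (fun x hx => hT x hx) (subset_dSupp T) (fun ν _ hx => sub_unitVec_mem_dSupp hx ν) z B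

/-- the weighted free instance: `F = Σ_{z∈Δ}η^dβ(z):|φ(z)|²:_{C^η_{M²}}` (e.g. `β = −½δm²_l`, `β = −λ_kC^η_{M²}(0)`), `dμ_{C^η_{M²}}` on `ηℤ^d`.
[cite: Balaban1983Higgs3, (2.24) p.430 (the admissible F)] -/
theorem eq_phi2_free_weighted (hη : 0 < η) (hM : 0 < M2) {T S : Finset (ZSite d)} {lam : ZSite d → ℝ}
    (hT : ∀ x, x ∉ T → lam x = 0) (hTS : T ⊆ S) (hTS' : ∀ ν : Fin d, ∀ x ∈ T, x - unitVec ν ∈ S) (Δ : Finset (ZSite d))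
    (β : ZSite d → ℝ) (B : ZSite d → Fin d → ℝ) :
    ∫ ω, (∑ z ∈ Δ, η ^ d * (β z * wick2K (CetaM d η M2) ω z)) * integrand226 C η (freeMeasure d N η M2) S B lam ω
      ∂freeMeasure d N η M2 = 0 :=
  eq_phi2_kernel_weighted C (Cv := CetaM d η M2) (isPosSemidefKernel_freeKernel hη hM) hη.ne' CetaM_neg
    (negLapZ_CetaM_add hη hM) hT hTS hTS' Δ β B

/-- **both members at free boundary conditions, the graphs displayed**: the Gaussian left member for `F = :|φ(z)|²:` equals the sum
of one-loop graphs of `eq_phi2_wickK` with propagators `C^η_{M²}` on `ηℤ^d`, and that sum is `0`. [cite: Balaban1983Higgs3, (2.28) p.431] -/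
theorem eq_phi2_free_graphs (hη : 0 < η) (hM : 0 < M2) {T S : Finset (ZSite d)} {lam : ZSite d → ℝ}
    (hT : ∀ x, x ∉ T → lam x = 0) (hTS : T ⊆ S) (hTS' : ∀ ν : Fin d, ∀ x ∈ T, x - unitVec ν ∈ S) (z : ZSite d)
    (B : ZSite d → Fin d → ℝ) :
    -C.e * ∑ y ∈ S, ∑ μ : Fin d, ∑ y' ∈ S, ∑ ν : Fin d,
          (η ^ d * B y μ * η⁻¹) * (η ^ d * pdiffZ η⁻¹ ν lam y' * η⁻¹) *
            (-2 * trE (C.q.comp C.q) *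
              (CetaM d η M2 (z - y) * CetaM d η M2 (z - y') * CetaM d η M2 (y + unitVec μ - (y' + unitVec ν))
                - CetaM d η M2 (z - y) * CetaM d η M2 (z - (y' + unitVec ν)) * CetaM d η M2 (y + unitVec μ - y')
                - CetaM d η M2 (z - (y + unitVec μ)) * CetaM d η M2 (z - y') * CetaM d η M2 (y - (y' + unitVec ν))
                + CetaM d η M2 (z - (y + unitVec μ)) * CetaM d η M2 (z - (y' + unitVec ν)) * CetaM d η M2 (y - y')))
        - C.e * ∑ y ∈ S, ∑ μ : Fin d, (η ^ d * (B y μ * pdiffZ η⁻¹ μ lam y)) *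
          (2 * (CetaM d η M2 (z - y) * CetaM d η M2 (z - y)) * trE (C.q.comp C.q))
        - (η * C.e) * ∑ y ∈ S, ∑ μ : Fin d,
          ((η ^ d * (B y μ * pdiffZ η⁻¹ μ lam y) * η⁻¹) *
              (2 * (CetaM d η M2 (z - (y + unitVec μ)) * CetaM d η M2 (z - y)) * trE (C.q.comp C.q))
            - (η ^ d * (B y μ * pdiffZ η⁻¹ μ lam y) * η⁻¹) *
              (2 * (CetaM d η M2 (z - y) * CetaM d η M2 (z - y)) * trE (C.q.comp C.q))) = 0 :=
  phi2Graphs_eq_zeroK C hη.ne' CetaM_neg (negLapZ_CetaM_add hη hM) hT hTS hTS' z B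

end Identity

end Literature.MathematicalPhysics.QuantumFieldTheory.Balaban1983to89.B3WT228Phi2FreeGaussian

end
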